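import Literature.NumberTheory.Rogawski1990.ArchTransfersExistCanonicalHaarFree   -- ★ p835598 (parts 1–3 of the ray files below it)
import HarnessLib

/-!
# The (S-d) RAY FILES, PART 4: the `∃ν` letter ★ `ArchCentralValueTransferExists` is FREE in the spectator measures — `ν_H`-independent and
# `ν′`-Haar-independent — so its ∀-closure ★ `ArchCentralValueTransferExistsClosed` follows from ONE witness per frame `(L, H′, T)`
(Rogawski, *Automorphic Representations of Unitary Groups in Three Variables* (1990), §1.7 p. 6, §14.5 p. 239)

Topic `NumberTheory/Rogawski1990`; namespace `Literature.NumberTheory.Rogawski1990`.  THEOREMS ONLY (no definition, no instance, no named fact, no notation,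
no `sorry`).  Cell `pub/hodgecm-mathlib`, ENGINE T1 (crux H413 = `stmt-HodgeConjecture-24833`); author F0P3a-p06 (g8) (T6-L2 pen); the reduction a floor-1
discharge of (S-d) starts from (`F0/P3a/F0P3a-p06/g8/ROAD-Sd-discharge.F0P3a-p06g8.md` §1).  Books count-neutral; nothing here proves (S-d).

* §1 `ArchCentralValueTransfer.nnreal_smul_H` — (S-d) at `(ν′, ν, ν_H)` gives (S-d) at `(ν′, ν, c_H•ν_H)` (`c_H ≠ 0`): a system at `c_H•ν_H` pulls back along
  `m_H ↦ c_H⁻¹•m_H` (★ `IsAdmissibleOn.smul`, ★ `IsQuotientOf.smul_of_eq_nnreal_smul`, ★ `IsArchDeltaTransferExists.smul_measure_left`) WITHOUT touching `(m′, m)`,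
  so the inner-transfer pairs and the conclusion are unchanged; `ArchCentralValueTransfer.of_isHaarMeasure_H` — hence (S-d) is the same statement for any two
  Haar `ν_H`.
* §2 `ArchCentralValueTransferExists.of_isHaarMeasure` — the `∃ν` letter at `(ν′₁, ν_{H,1})` implies it at `(ν′₂, ν_{H,2})` for any Haar right-invariant choices
  (part 2's `ν′`-covariance ★ `ArchCentralValueTransferExists.nnreal_smul` + §1); **`archCentralValueTransferExistsClosed_of_forall_exists`** — THE FLOOR-1 SHAPE:
  `(∀ frame (L, H′, T, σ-algebras), ∃ Haar right-invariant ν′, ν_H with ArchCentralValueTransferExists L H′ T ν′ ν_H) → ArchCentralValueTransferExistsClosed`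
  (one witness per frame suffices; with part 1 the witness `ν` is then forced for every `ν′`).
HONEST LABEL: HC_CM is proved only modulo the printed citations until rung 0 closes; this file is unconditional and proves no printed statement.

## References
* [Rogawski1990] J. D. Rogawski, *Automorphic Representations of Unitary Groups in Three Variables*, Ann. of Math. Stud. 123 (1990), §1.7 p. 6, §14.5 p. 239.
* [DeitmarEchterhoff2014] A. Deitmar, S. Echterhoff, *Principles of Harmonic Analysis*, 2nd ed. (2014), Thm. 1.5.3.
-/

noncomputable section

open MeasureTheory Measure NumberField NumberField.InfinitePlace IsDedekindDomain Filter Topology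
open Literature.MeasureTheory.Group
open scoped ENNReal NNReal Matrix ComplexOrder Classical

namespace Literature.NumberTheory.Rogawski1990

open Literature.NumberTheory.Automorphic Literature.NumberTheory.GaloisRepresentations
open Literature.AlgebraicGeometry.ShimuraVarieties (unitaryGroup hermForm)

section Arch

variable (L : Type) [Field L] [NumberField L] [IsCMField L] (H' : Matrix (Fin 3) (Fin 3) L)

variable (T : ArchTransferFactor L H')
  [MeasurableSpace (UnitaryGroup.arch (↥(maximalRealSubfield L)) L (IsCMField.complexConj L) 3 H')]
  [BorelSpace (UnitaryGroup.arch (↥(maximalRealSubfield L)) L (IsCMField.complexConj L) 3 H')]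
  [MeasurableSpace (UnitaryGroup.arch (↥(maximalRealSubfield L)) L (IsCMField.complexConj L) 3
    (Matrix.of fun i j : Fin 3 => if i.val + j.val + 1 = 3 then (1 : L) else 0))]
  [BorelSpace (UnitaryGroup.arch (↥(maximalRealSubfield L)) L (IsCMField.complexConj L) 3
    (Matrix.of fun i j : Fin 3 => if i.val + j.val + 1 = 3 then (1 : L) else 0))]
  [MeasurableSpace (UnitaryGroup.arch (↥(maximalRealSubfield L)) L (IsCMField.complexConj L) 2
          (Matrix.of fun i j : Fin 2 => if i.val + j.val + 1 = 2 then (1 : L) else 0) ×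
        UnitaryGroup.arch (↥(maximalRealSubfield L)) L (IsCMField.complexConj L) 1
          (Matrix.of fun i j : Fin 1 => if i.val + j.val + 1 = 1 then (1 : L) else 0))]
  [BorelSpace (UnitaryGroup.arch (↥(maximalRealSubfield L)) L (IsCMField.complexConj L) 2
          (Matrix.of fun i j : Fin 2 => if i.val + j.val + 1 = 2 then (1 : L) else 0) ×
        UnitaryGroup.arch (↥(maximalRealSubfield L)) L (IsCMField.complexConj L) 1
          (Matrix.of fun i j : Fin 1 => if i.val + j.val + 1 = 1 then (1 : L) else 0))]
  (ν' : Measure (UnitaryGroup.arch (↥(maximalRealSubfield L)) L (IsCMField.complexConj L) 3 H'))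
  (ν : Measure (UnitaryGroup.arch (↥(maximalRealSubfield L)) L (IsCMField.complexConj L) 3
    (Matrix.of fun i j : Fin 3 => if i.val + j.val + 1 = 3 then (1 : L) else 0)))
  (νH : Measure (UnitaryGroup.arch (↥(maximalRealSubfield L)) L (IsCMField.complexConj L) 2
          (Matrix.of fun i j : Fin 2 => if i.val + j.val + 1 = 2 then (1 : L) else 0) ×
        UnitaryGroup.arch (↥(maximalRealSubfield L)) L (IsCMField.complexConj L) 1
          (Matrix.of fun i j : Fin 1 => if i.val + j.val + 1 = 1 then (1 : L) else 0)))
  [IsFiniteMeasureOnCompacts ν'] [ν'.IsMulRightInvariant] [IsFiniteMeasureOnCompacts ν] [ν.IsMulRightInvariant]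
  [νH.IsHaarMeasure] [νH.IsMulRightInvariant]

/-! ## §1 `ν_H` is a spectator -/

/-- **(S-d) at `(ν′, ν, c_H•ν_H)` from (S-d) at `(ν′, ν, ν_H)`** (`c_H ≠ 0`, Haar right-invariant `ν_H`): a thirteen-conjunct system at `c_H•ν_H` pulls back along
`m_H ↦ c_H⁻¹•m_H` to one at `ν_H` with the SAME `(m′, m)`, hence the same inner-transfer pairs and the same central values. [cite: Rogawski1990, §1.7 p. 6; §14.5 p. 239] -/
theorem ArchCentralValueTransfer.nnreal_smul_H (h : ArchCentralValueTransfer L H' T ν' ν νH) {cH : ℝ≥0} (hcH : cH ≠ 0) :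
    ArchCentralValueTransfer L H' T ν' ν (cH • νH) := by
  intro hherm hanis hS₀ iGpm iGpb iGm iGb iHm iHb m' m mH t' t tH hbody a' a ha' ha hrel γ₀ γ ζ hγ₀ hγ
  obtain ⟨hi, hii, hiii, hiv, hv, hvi, hW', hW, hWH, hC', hC, hC'G, hCH⟩ := hbody
  have hκ0 : ((cH⁻¹ : ℝ≥0) : ℝ≥0∞) ≠ 0 := ENNReal.coe_ne_zero.2 (inv_ne_zero hcH)
  haveI : (cH • νH).IsHaarMeasure := IsHaarMeasure.nnreal_smul νH hcH
  have hνH : νH = cH⁻¹ • (cH • νH) := by rw [smul_smul, inv_mul_cancel₀ hcH, one_smul]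
  exact h hherm hanis hS₀ m' m (HSMul.hSMul ((cH⁻¹ : ℝ≥0) : ℝ≥0∞) mH) t' t tH
    ⟨hi, hii, hiii.smul hκ0 ENNReal.coe_ne_top, hiv, hv, IsArchDeltaTransferExists.smul_measure_left L H' hvi hκ0 ENNReal.coe_ne_top,
      hW', hW, hWH.smul_of_eq_nnreal_smul (inv_ne_zero hcH) hνH, hC', hC, hC'G, hCH⟩
    a' a ha' ha hrel γ₀ γ ζ hγ₀ hγ

/-- **(S-d) does not depend on the Haar measure `ν_H` of `H_∞`**: for Haar right-invariant `ν_{H,1}`, `ν_{H,2}`, (S-d) at `(ν′, ν, ν_{H,1})` implies (S-d) at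
`(ν′, ν, ν_{H,2})`. [cite: Rogawski1990, §1.7 p. 6; §14.5 p. 239] [cite: DeitmarEchterhoff2014, Thm. 1.5.3] -/
theorem ArchCentralValueTransfer.of_isHaarMeasure_H
    (νH₂ : Measure (UnitaryGroup.arch (↥(maximalRealSubfield L)) L (IsCMField.complexConj L) 2
          (Matrix.of fun i j : Fin 2 => if i.val + j.val + 1 = 2 then (1 : L) else 0) ×
        UnitaryGroup.arch (↥(maximalRealSubfield L)) L (IsCMField.complexConj L) 1
          (Matrix.of fun i j : Fin 1 => if i.val + j.val + 1 = 1 then (1 : L) else 0))) [νH₂.IsHaarMeasure] [νH₂.IsMulRightInvariant]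
    (h : ArchCentralValueTransfer L H' T ν' ν νH) : ArchCentralValueTransfer L H' T ν' ν νH₂ := by
  have key := ArchCentralValueTransfer.nnreal_smul_H L H' T ν' ν νH h (Measure.haarScalarFactor_pos_of_isHaarMeasure νH₂ νH).ne'
  revert key
  have aux : ∀ (μH : Measure (UnitaryGroup.arch (↥(maximalRealSubfield L)) L (IsCMField.complexConj L) 2
          (Matrix.of fun i j : Fin 2 => if i.val + j.val + 1 = 2 then (1 : L) else 0) ×
        UnitaryGroup.arch (↥(maximalRealSubfield L)) L (IsCMField.complexConj L) 1
          (Matrix.of fun i j : Fin 1 => if i.val + j.val + 1 = 1 then (1 : L) else 0))) [IsFiniteMeasureOnCompacts μH] [μH.IsMulRightInvariant],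
      μH = νH₂ → ArchCentralValueTransfer L H' T ν' ν μH → ArchCentralValueTransfer L H' T ν' ν νH₂ := by
    intro μH _ _ h1 hμ
    subst h1
    exact hμ
  exact aux _ (isHaarMeasure_eq_haarScalarFactor_smul νH νH₂).symm

end Arch

/-! ## §2 The `∃ν` letter in the spectator measures; the floor-1 shape of the closed letter -/

section Exists

variable (L : Type) [Field L] [NumberField L] [IsCMField L] (H' : Matrix (Fin 3) (Fin 3) L)

variable (T : ArchTransferFactor L H')
  [MeasurableSpace (UnitaryGroup.arch (↥(maximalRealSubfield L)) L (IsCMField.complexConj L) 3 H')]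
  [BorelSpace (UnitaryGroup.arch (↥(maximalRealSubfield L)) L (IsCMField.complexConj L) 3 H')]
  [MeasurableSpace (UnitaryGroup.arch (↥(maximalRealSubfield L)) L (IsCMField.complexConj L) 3
    (Matrix.of fun i j : Fin 3 => if i.val + j.val + 1 = 3 then (1 : L) else 0))]
  [BorelSpace (UnitaryGroup.arch (↥(maximalRealSubfield L)) L (IsCMField.complexConj L) 3
    (Matrix.of fun i j : Fin 3 => if i.val + j.val + 1 = 3 then (1 : L) else 0))]
  [MeasurableSpace (UnitaryGroup.arch (↥(maximalRealSubfield L)) L (IsCMField.complexConj L) 2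
          (Matrix.of fun i j : Fin 2 => if i.val + j.val + 1 = 2 then (1 : L) else 0) ×
        UnitaryGroup.arch (↥(maximalRealSubfield L)) L (IsCMField.complexConj L) 1
          (Matrix.of fun i j : Fin 1 => if i.val + j.val + 1 = 1 then (1 : L) else 0))]
  [BorelSpace (UnitaryGroup.arch (↥(maximalRealSubfield L)) L (IsCMField.complexConj L) 2
          (Matrix.of fun i j : Fin 2 => if i.val + j.val + 1 = 2 then (1 : L) else 0) ×
        UnitaryGroup.arch (↥(maximalRealSubfield L)) L (IsCMField.complexConj L) 1
          (Matrix.of fun i j : Fin 1 => if i.val + j.val + 1 = 1 then (1 : L) else 0))]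

/-- **The `∃ν` letter is free in `(ν′, ν_H)` among Haar measures**: ★ `ArchCentralValueTransferExists L H′ T ν′₁ ν_{H,1}` implies the same at any other Haar
right-invariant `(ν′₂, ν_{H,2})` (the witness rescales with `ν′`, part 2; `ν_H` is a spectator, §1). [cite: Rogawski1990, §1.7 p. 6; §14.5 p. 239]
[cite: DeitmarEchterhoff2014, Thm. 1.5.3] -/
theorem ArchCentralValueTransferExists.of_isHaarMeasure
    (ν'₁ ν'₂ : Measure (UnitaryGroup.arch (↥(maximalRealSubfield L)) L (IsCMField.complexConj L) 3 H'))
    (νH₁ νH₂ : Measure (UnitaryGroup.arch (↥(maximalRealSubfield L)) L (IsCMField.complexConj L) 2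
          (Matrix.of fun i j : Fin 2 => if i.val + j.val + 1 = 2 then (1 : L) else 0) ×
        UnitaryGroup.arch (↥(maximalRealSubfield L)) L (IsCMField.complexConj L) 1
          (Matrix.of fun i j : Fin 1 => if i.val + j.val + 1 = 1 then (1 : L) else 0)))
    [ν'₁.IsHaarMeasure] [ν'₁.IsMulRightInvariant] [νH₁.IsHaarMeasure] [νH₁.IsMulRightInvariant]
    [ν'₂.IsHaarMeasure] [ν'₂.IsMulRightInvariant] [νH₂.IsHaarMeasure] [νH₂.IsMulRightInvariant]
    (h : ArchCentralValueTransferExists L H' T ν'₁ νH₁) : ArchCentralValueTransferExists L H' T ν'₂ νH₂ := by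
  -- rescale `ν′` (part 2), then move `ν_H` (§1) inside the `∃`
  have key := ArchCentralValueTransferExists.nnreal_smul L H' T ν'₁ νH₁ h (Measure.haarScalarFactor_pos_of_isHaarMeasure ν'₂ ν'₁).ne'
  revert key
  have aux : ∀ (μ' : Measure (UnitaryGroup.arch (↥(maximalRealSubfield L)) L (IsCMField.complexConj L) 3 H')) [IsFiniteMeasureOnCompacts μ'] [μ'.IsMulRightInvariant],
      μ' = ν'₂ → ArchCentralValueTransferExists L H' T μ' νH₁ → ArchCentralValueTransferExists L H' T ν'₂ νH₂ := by
    intro μ' _ _ h1 hμ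
    subst h1
    obtain ⟨μ, hμ1, hμ2, hSd⟩ := hμ
    haveI := hμ1
    haveI := hμ2
    unfold ArchCentralValueTransferExists
    exact ⟨μ, hμ1, hμ2, ArchCentralValueTransfer.of_isHaarMeasure_H L H' T _ μ νH₁ νH₂ hSd⟩
  exact aux _ (isHaarMeasure_eq_haarScalarFactor_smul ν'₁ ν'₂).symm

/-- **THE FLOOR-1 SHAPE OF THE CLOSED LETTER**: to prove ★ `ArchCentralValueTransferExistsClosed` it suffices to produce, for every frame `(L, H′, T, σ-algebras)`,
ONE pair of Haar right-invariant measures `(ν′, ν_H)` at which the `∃ν` letter holds — the closed letter's ∀ over `(ν′, ν_H)` then follows by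
`ArchCentralValueTransferExists.of_isHaarMeasure`; and by part 1 (★ `ArchCentralValueTransfer.measure_eq`) the witness `ν` is forced at every `ν′`.
[cite: Rogawski1990, §1.7 p. 6; §14.5 p. 239] -/
theorem archCentralValueTransferExistsClosed_of_forall_exists
    (h : ∀ (L : Type) [Field L] [NumberField L] [IsCMField L] (H' : Matrix (Fin 3) (Fin 3) L) (T : ArchTransferFactor L H')
  [MeasurableSpace (UnitaryGroup.arch (↥(maximalRealSubfield L)) L (IsCMField.complexConj L) 3 H')]
  [BorelSpace (UnitaryGroup.arch (↥(maximalRealSubfield L)) L (IsCMField.complexConj L) 3 H')]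
  [MeasurableSpace (UnitaryGroup.arch (↥(maximalRealSubfield L)) L (IsCMField.complexConj L) 3
    (Matrix.of fun i j : Fin 3 => if i.val + j.val + 1 = 3 then (1 : L) else 0))]
  [BorelSpace (UnitaryGroup.arch (↥(maximalRealSubfield L)) L (IsCMField.complexConj L) 3
    (Matrix.of fun i j : Fin 3 => if i.val + j.val + 1 = 3 then (1 : L) else 0))]
  [MeasurableSpace (UnitaryGroup.arch (↥(maximalRealSubfield L)) L (IsCMField.complexConj L) 2
          (Matrix.of fun i j : Fin 2 => if i.val + j.val + 1 = 2 then (1 : L) else 0) ×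
        UnitaryGroup.arch (↥(maximalRealSubfield L)) L (IsCMField.complexConj L) 1
          (Matrix.of fun i j : Fin 1 => if i.val + j.val + 1 = 1 then (1 : L) else 0))]
  [BorelSpace (UnitaryGroup.arch (↥(maximalRealSubfield L)) L (IsCMField.complexConj L) 2
          (Matrix.of fun i j : Fin 2 => if i.val + j.val + 1 = 2 then (1 : L) else 0) ×
        UnitaryGroup.arch (↥(maximalRealSubfield L)) L (IsCMField.complexConj L) 1
          (Matrix.of fun i j : Fin 1 => if i.val + j.val + 1 = 1 then (1 : L) else 0))],
      ∃ (ν' : Measure (UnitaryGroup.arch (↥(maximalRealSubfield L)) L (IsCMField.complexConj L) 3 H')) (νH : Measure (UnitaryGroup.arch (↥(maximalRealSubfield L)) L (IsCMField.complexConj L) 2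
          (Matrix.of fun i j : Fin 2 => if i.val + j.val + 1 = 2 then (1 : L) else 0) ×
        UnitaryGroup.arch (↥(maximalRealSubfield L)) L (IsCMField.complexConj L) 1
          (Matrix.of fun i j : Fin 1 => if i.val + j.val + 1 = 1 then (1 : L) else 0)))
        (_ : ν'.IsHaarMeasure) (_ : ν'.IsMulRightInvariant) (_ : νH.IsHaarMeasure) (_ : νH.IsMulRightInvariant),
        ArchCentralValueTransferExists L H' T ν' νH) :
    ArchCentralValueTransferExistsClosed := by
  intro L _ _ _ H' T _ _ _ _ _ _ ν' νH _ _ _ _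
  obtain ⟨ν'₁, νH₁, h1, h2, h3, h4, hex⟩ := h L H' T
  haveI := h1; haveI := h2; haveI := h3; haveI := h4
  exact ArchCentralValueTransferExists.of_isHaarMeasure L H' T ν'₁ ν' νH₁ νH hex

end Exists

end Literature.NumberTheory.Rogawski1990

end
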